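import Literature.NumberTheory.LFunctions.YoshidaWindowGramFrontDoor
import Literature.Analysis.ValidatedNumerics.BernoulliNumbersTable
import HarnessLib

/-!
# C∞ certificate pipeline — HIGH-PRECISION special-value records (21-term Stirling series)

The format-C special-value records (`Encl.idxRec` / `Encl.idxRecCol`, validated by `Encl.checkTable` /
`Encl.checkTableCol`) evaluate `ψ(¼ + iω/2)` and `ψ′` by the shifted Stirling series with the 10-term Bernoulli list
`MC.bernoulliTable`; with the kernel-rung parameters (shift `J = 120`) the certified remainder is `≈ 2^-132`, which is
the width of every kernel box built from those records.  The C∞ pipeline needs the sector kernel `Kb` to `≈ 2^-231`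
absolute (even sector, `a = 1`; HOME/rh-explicit-weil-2/gen17/EMITTER-PHASE2.md §K): this file is the SAME pair of
evaluators with the 21-term list `MC.bernoulliTable42` (remainder `≈ 2^-249` at `J = 160`), their validity, and the
table checkers with soundness — so that a rung can certify `Encl.TabValid` / `Encl.TabColValid` tables of any precision
the scale `S` and the series lengths allow (measured: all record fields `≤ 2^-244` wide at `S = 2^300`, `Kser = 270`,
`J = 160`).  The records have the unchanged type `Encl.IdxRec`, so every downstream box lemma (`Encl.mem_sectorBox`,
`Encl.mem_sectorColBox`, `CinfPrimK.mem_kBox`, …) applies verbatim.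

* `idxRecHP` / `idxValid_of_idxRecHP` — full record (`Encl.IdxValid`);
* `checkTableHP` / `idxValid_of_checkTableHP` — kernel check of a stored full table slice;
* `idxRecColHP` / `colValid_of_idxRecColHP` — light record (`Encl.ColValid`);
* `checkTableColHP` / `colValid_of_checkTableColHP` — kernel check of a stored light table slice.

weil-2 gen17; supporting stmt-RiemannHypothesis-0098; interval plumbing only; standard axioms; no RH claim.
-/

set_option autoImplicit false
-- `Summit.RiemannHypothesis.RiemannHypothesis.…` is the layout-mandated namespace (summit = problem name).
set_option linter.dupNamespace false

namespace Summit.RiemannHypothesis.RiemannHypothesis.Theorems.WeilFormatC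

open Literature.NumberTheory.LFunctions Literature.NumberTheory.LFunctions.Yoshida1992
open Literature.Analysis.ValidatedNumerics.NumericsMP
open Encl

namespace CinfRecHP

variable {a : ℝ} {prm : Params} {ks : List PrimeLen} {C : Consts}

/-- The 21-term Bernoulli list is a valid coefficient list for `MC.digammaBox` / `MC.trigammaBox`. -/
theorem bernoulliTable42_coeffs :
    ∀ k < MC.bernoulliTable42.length, ((MC.bernoulliTable42.getD k 0 : ℚ) : ℂ) = (bernoulli (2 * (k + 1)) : ℂ) :=
  fun k hk ↦ by
    have hk' : k < 21 := by simpa [MC.bernoulliTable42] using hk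
    exact_mod_cast MC.bernoulliTable42_getD hk'

/-- The 21-term Bernoulli list is not empty. -/
theorem bernoulliTable42_ne_nil : MC.bernoulliTable42 ≠ [] := by simp [MC.bernoulliTable42]

/-! ## Full records -/

/-- **High-precision full record at the mode `n`**: `Encl.idxRec` with the 21-term Stirling coefficient list. -/
def idxRecHP (prm : Params) (C : Consts) (n : ℕ) : Option IdxRec :=
  match MI.divPos prm.S (C.P.mulInt n) C.A with
  | none => none
  | some om =>
    match MI.divPos prm.S (MI.ofInt prm.S 1) ((MI.ofInt prm.S 1).add ((om.sqr prm.S).mulInt 4)),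
          MC.digammaBox prm.S prm.Kser prm.J C.P MC.bernoulliTable42 (quarterBox prm.S om),
          MC.trigammaBox prm.S prm.J MC.bernoulliTable42 (quarterBox prm.S om) with
    | some c, some Ψ, some Ψ' =>
      match dsum prm.S (om.sqr prm.S) 0 C.eks, ssum prm.S om (om.sqr prm.S) 0 C.eks,
            omap (fun L ↦ MC.expI prm.S prm.Kser prm.kred C.P (om.mul prm.S L)) C.lens with
      | some eD, some eS, some cs =>
          some ⟨om, c, Ψ.im, eS.widen C.tailE, cs, Ψ.re, Ψ'.re, eD.widen C.tailE⟩
      | _, _, _ => none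
    | _, _, _ => none

/-- **`idxRecHP` is valid** (the proof of `Encl.idxValid_of_idxRec` with the 21-term coefficient facts). -/
theorem idxValid_of_idxRecHP (hS : 0 < prm.S) (ha0 : 0 < a) (hC : ConstsValid prm.S a ks C) {n : ℕ} {R : IdxRec}
    (h : idxRecHP prm C n = some R) : IdxValid prm.S a ks n R := by
  unfold idxRecHP at h
  split at h
  · simp at h
  · rename_i om hom
    split at h
    · rename_i c Ψ Ψ' hc hΨ hΨ'
      split at h
      · rename_i eD eS cs heD heS hcs
        simp only [Option.some.injEq] at h
        subst h
        have hω : MI.mem prm.S (freq a n) om := by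
          refine mem_of_eq (MI.mem_divPos hS hom (MI.mem_mulInt hC.pi n) hC.ha) ?_
          unfold freq; push_cast; ring
        have hω2 : MI.mem prm.S (freq a n ^ 2) (om.sqr prm.S) := MI.mem_sqr hS hω
        have hW := mem_quarterBox (S := prm.S) hω
        have hψ := MC.mem_digammaBox hS hC.pi bernoulliTable42_ne_nil bernoulliTable42_coeffs hΨ hW
        have hψ' := MC.mem_trigammaBox hS bernoulliTable42_ne_nil bernoulliTable42_coeffs hΨ' hW
        have hK : 1 ≤ C.eks.length := hC.eks_pos
        have heD' := mem_dsum (a := a) hS hω2 C.eks 0 (fun i hi ↦ by simpa using hC.eks i hi) heD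
        have heS' := mem_ssum (a := a) hS hω hω2 C.eks 0 (fun i hi ↦ by simpa using hC.eks i hi) heS
        simp only [Nat.zero_add] at heD' heS'
        have htailD : |archExpSumDiag a n - ∑ i ∈ Finset.range C.eks.length, diagTerm a n i| * prm.S ≤ C.tailE :=
          le_trans (mul_le_mul_of_nonneg_right (abs_archExpSumDiag_sub_sum_le ha0 n hK) (Nat.cast_nonneg _)) hC.tail
        have htailS : |archExpSumSin a n - ∑ i ∈ Finset.range C.eks.length, sinTerm a n i| * prm.S ≤ C.tailE :=
          le_trans (mul_le_mul_of_nonneg_right (abs_archExpSumSin_sub_sum_le ha0 n _) (Nat.cast_nonneg _)) hC.tail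
        obtain ⟨hcsl, hcsi⟩ := omap_spec hcs
        refine ⟨{ om := hω, c := ?_, imP := hψ.2, eS := ?_, cs_len := by rw [hcsl, hC.lens_len], cs := ?_ },
          { reP := hψ.1, rePD := hψ'.1, eD := ?_ }⟩
        · refine mem_of_eq (MI.mem_divPos hS hc (MI.mem_ofInt prm.S 1)
            (MI.mem_add (MI.mem_ofInt prm.S 1) (MI.mem_mulInt hω2 4))) ?_
          push_cast; ring
        · exact MI.mem_widen heS' htailS
        · intro i hi
          rw [← hC.lens_len] at hi
          exact MC.mem_expI hS hC.pi (hcsi i hi) (MI.mem_mul hS hω (hC.lens i (hC.lens_len ▸ hi)))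
        · exact MI.mem_widen heD' htailD
      · simp at h
    · simp at h

/-- Check the stored full table on the modes `n0 ≤ n < n0 + k` against `idxRecHP`. -/
def checkTableHP (prm : Params) (C : Consts) (tab : List IdxRec) (n0 k : ℕ) : Bool :=
  (List.range k).all fun i ↦
    match idxRecHP prm C (n0 + i) with
    | some R => IdxRec.within R (tget tab (n0 + i))
    | none => false

/-- **Soundness of `checkTableHP`.** -/
theorem idxValid_of_checkTableHP (hS : 0 < prm.S) (ha0 : 0 < a) (hC : ConstsValid prm.S a ks C)
    {tab : List IdxRec} {n0 k : ℕ} (h : checkTableHP prm C tab n0 k = true) {n : ℕ} (hn : n0 ≤ n)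
    (hnk : n < n0 + k) : IdxValid prm.S a ks n (tget tab n) := by
  unfold checkTableHP at h
  rw [List.all_eq_true] at h
  have hi := h (n - n0) (List.mem_range.mpr (by omega))
  rw [show n0 + (n - n0) = n by omega] at hi
  split at hi
  · rename_i R hR; exact IdxValid.of_within hi (idxValid_of_idxRecHP hS ha0 hC hR)
  · simp at hi

/-- Glue consecutive certified full-table slices into `Encl.TabValid`. -/
theorem tabValid_extend {S : ℕ} {N k : ℕ} {tab : List IdxRec} (h1 : TabValid S a ks N tab)
    (h2 : ∀ n, N ≤ n → n < N + k → IdxValid S a ks n (tget tab n)) : TabValid S a ks (N + k) tab :=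
  fun n hn ↦ if h : n < N then h1 n h else h2 n (by omega) hn

/-- The empty full table range. -/
theorem tabValid_zero {S : ℕ} {tab : List IdxRec} : TabValid S a ks 0 tab := fun n hn ↦ absurd hn (by omega)

/-! ## Light records -/

/-- **High-precision light record at the mode `n`**: `Encl.idxRecCol` with the 21-term Stirling coefficient list. -/
def idxRecColHP (prm : Params) (C : Consts) (n : ℕ) : Option IdxRec :=
  match MI.divPos prm.S (C.P.mulInt n) C.A with
  | none => none
  | some om =>
    match MI.divPos prm.S (MI.ofInt prm.S 1) ((MI.ofInt prm.S 1).add ((om.sqr prm.S).mulInt 4)),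
          MC.digammaBox prm.S prm.Kser prm.J C.P MC.bernoulliTable42 (quarterBox prm.S om) with
    | some c, some Ψ =>
      match ssum prm.S om (om.sqr prm.S) 0 C.eks,
            omap (fun L ↦ MC.expI prm.S prm.Kser prm.kred C.P (om.mul prm.S L)) C.lens with
      | some eS, some cs => some ⟨om, c, Ψ.im, eS.widen C.tailE, cs, Ψ.re, MI.ofInt prm.S 0, MI.ofInt prm.S 0⟩
      | _, _ => none
    | _, _ => none

/-- **`idxRecColHP` is valid** (the proof of `Encl.colValid_of_idxRecCol` with the 21-term coefficient facts). -/
theorem colValid_of_idxRecColHP (hS : 0 < prm.S) (ha0 : 0 < a) (hC : ConstsValid prm.S a ks C) {n : ℕ}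
    {R : IdxRec} (h : idxRecColHP prm C n = some R) : ColValid prm.S a ks n R := by
  unfold idxRecColHP at h
  split at h
  · simp at h
  · rename_i om hom
    split at h
    · rename_i c Ψ hc hΨ
      split at h
      · rename_i eS cs heS hcs
        simp only [Option.some.injEq] at h
        subst h
        have hω : MI.mem prm.S (freq a n) om := by
          refine mem_of_eq (MI.mem_divPos hS hom (MI.mem_mulInt hC.pi n) hC.ha) ?_
          unfold freq; push_cast; ring
        have hω2 : MI.mem prm.S (freq a n ^ 2) (om.sqr prm.S) := MI.mem_sqr hS hω
        have hW := mem_quarterBox (S := prm.S) hω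
        have hψ := MC.mem_digammaBox hS hC.pi bernoulliTable42_ne_nil bernoulliTable42_coeffs hΨ hW
        have heS' := mem_ssum (a := a) hS hω hω2 C.eks 0 (fun i hi ↦ by simpa using hC.eks i hi) heS
        simp only [Nat.zero_add] at heS'
        have htailS : |archExpSumSin a n - ∑ i ∈ Finset.range C.eks.length, sinTerm a n i| * prm.S ≤ C.tailE :=
          le_trans (mul_le_mul_of_nonneg_right (abs_archExpSumSin_sub_sum_le ha0 n _) (Nat.cast_nonneg _)) hC.tail
        obtain ⟨hcsl, hcsi⟩ := omap_spec hcs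
        refine ⟨{ om := hω, c := ?_, imP := hψ.2, eS := MI.mem_widen heS' htailS,
                  cs_len := by rw [hcsl, hC.lens_len], cs := ?_ }, hψ.1⟩
        · refine mem_of_eq (MI.mem_divPos hS hc (MI.mem_ofInt prm.S 1)
            (MI.mem_add (MI.mem_ofInt prm.S 1) (MI.mem_mulInt hω2 4))) ?_
          push_cast; ring
        · intro i hi
          rw [← hC.lens_len] at hi
          exact MC.mem_expI hS hC.pi (hcsi i hi) (MI.mem_mul hS hω (hC.lens i (hC.lens_len ▸ hi)))
      · simp at h
    · simp at h

/-- Check the stored light table on the modes `n0 ≤ m < n0 + k` against `idxRecColHP`. -/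
def checkTableColHP (prm : Params) (C : Consts) (ctab : List IdxRec) (n0 k : ℕ) : Bool :=
  (List.range k).all fun i ↦
    match idxRecColHP prm C (n0 + i) with
    | some R => IdxRec.withinCol R (tget ctab (n0 + i))
    | none => false

/-- **Soundness of `checkTableColHP`.** -/
theorem colValid_of_checkTableColHP (hS : 0 < prm.S) (ha0 : 0 < a) (hC : ConstsValid prm.S a ks C)
    {ctab : List IdxRec} {n0 k : ℕ} (h : checkTableColHP prm C ctab n0 k = true) {m : ℕ} (hm : n0 ≤ m)
    (hmk : m < n0 + k) : ColValid prm.S a ks m (tget ctab m) := by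
  unfold checkTableColHP at h
  rw [List.all_eq_true] at h
  have hi := h (m - n0) (List.mem_range.mpr (by omega))
  rw [show n0 + (m - n0) = m by omega] at hi
  split at hi
  · rename_i R hR; exact ColValid.of_within hi (colValid_of_idxRecColHP hS ha0 hC hR)
  · simp at hi

end CinfRecHP

end Summit.RiemannHypothesis.RiemannHypothesis.Theorems.WeilFormatC
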